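import Summits.BirchSwinnertonDyer.BirchSwinnertonDyer.Theorems.ByReductionTypeAtTwoSupersingularFlatBlindCardTransport
import Summits.BirchSwinnertonDyer.BirchSwinnertonDyer.Theorems.ByReductionTypeAtTwoSupersingularFlatBlindTwistCurveSide
import Summits.BirchSwinnertonDyer.BirchSwinnertonDyer.Theorems.ByReductionTypeAtTwoSupersingularFlatBlindTwistSideKummerLine
import Summits.BirchSwinnertonDyer.Rank1Residual.F1Sign2.HondaSystemAtTwo
import Literature.NumberTheory.EllipticCurves.LocalEulerCharacteristicTorsion
import Mathlib.NumberTheory.Padics.HeightOneSpectrum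
import HarnessLib

/-!
# Route `ByReductionTypeAtTwo` (rung K4), crux `SupersingularRankZeroAtTwo` (item stmt-BirchSwinnertonDyer-19097), line
# `odd_blind_package` (registry v2.10.1), slot 5 `stub_CD` = CDC_H: **THE LOCAL LINE GLUE — binder (B3loc) (LINE COMPLEMENT at `v ∣ 2`
# on the `W₂`-side, quantified over the twist dictionary `(φ, ψ)`) from a `φ/ψ`-FREE E-SIDE STATEMENT (transversality of the
# ♭-line to the layer-1 anti-invariant Kummer classes + the line bound `2^J ≤ #L^E_J`) and Tate's local Euler–Poincaré
# characteristic at `ℚ_v`** (cell `bsd-2adic`, LEAD ss-1 GEN 21; memo `HOME/ss/gen21/HAND-TARGETS-CDC-4.md`)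

HONEST FRAMING. `lineComplement_of_transversal_of_lineCard (hE) (hEP) : <hloc of the position glue, VERBATIM>` is a REDUCTION:
* (hE) E-SIDE LINE FACTS at `v ∣ 2` (no `W₂`, no `φ/ψ`): for `J ≥ J₃`, `L^E_J ⊓ 𝓚_J(M₁⁻) = ⊥` — `L^E_J` the ♭-line
  `twistedSharpFlatLocalFamily … v … v ≤ H¹(ℚ_v, E[2^J](χ₋₁))`, `𝓚_J(M₁⁻)` the twisted Kummer classes of the layer-1 points killed by
  `g + 1` (`twistedTorsionLocalKummer … (localLayerPointsOfEmb κ _ W 1 ⊓ ker (g+1))`) — and `2^J ≤ #L^E_J`;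
* (hEP) Milne *ADT* I Thm. 2.8 at `ℚ_v` (`Literature.…localEulerPoincareCharacteristic`, the tree's named fact; print binder).
PROOF. (⊥) for `y = H¹(ψ_v) l ∈ Kum_J(W₂)_v`, clause (iv) of the dictionary puts `H¹(φ_v) y = l` (by `φ ∘ ψ = id`) in `𝓚_J(M₁⁻)`,
so `l ∈ L^E_J ⊓ 𝓚_J(M₁⁻) = ⊥`. (⊤) by counting in the finite group `A_J = H¹(ℚ_v, W₂[2^J])`: `#Kum_J(W₂)_v = #W₂(ℚ_v)[2^J] · #(𝓞_v/2^J)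
= 2^J` (`W₂(ℚ_v)[2] = 0` ★ p814209; `𝓞_v ≅ ℤ₂`), `#H¹(ℚ_v, W₂)[2^J] = 2^J` (Tate local duality for `E`, from (hEP): tree
`natCard_torsionBy_galoisCohomology_localGaloisModule_eq_of_localEuler`), hence `#A_J = 2^{2J}` (`natCard_torsionBy_… _mul`);
`#H¹(ψ_v)(L^E_J) = #L^E_J ≥ 2^J` (`ψ` injective); with (⊥) the subgroup `H¹(ψ_v)(L^E_J) ⊔ Kum_J` has `≥ 2^{2J} = #A_J` elements.
Typed ≠ proved: (hE) is a hypothesis (the LINE hand's target), (hEP) a named fact; nothing is booked; 19097 OPEN; BSD proved for no curve.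
bears_on: K4 (19097). References: [MilneADT2006] I Thm. 2.8, Thm. 3.2, Lemma 3.3; [GreenbergLNM1716] §4; [Sprung2012] Def. 7.9/7.11.
-/

set_option autoImplicit false
set_option linter.dupNamespace false

noncomputable section

open scoped Classical NumberField AddSubgroup ContRepresentation

namespace Summit.BirchSwinnertonDyer.BirchSwinnertonDyer.Theorems

namespace OddBlindLocal

open NumberField IsDedekindDomain Field WeierstrassCurve Literature.NumberTheory.EllipticCurves
open Literature.NumberTheory.GaloisRepresentations Literature.NumberTheory.GaloisCohomology
open Literature.NumberTheory.EllipticCurves.Kobayashi2003 Literature.NumberTheory.EllipticCurves.Sprung2012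
  Literature.NumberTheory.EllipticCurves.Sprung2017 Literature.NumberTheory.EllipticCurves.ZpExtension
  Literature.NumberTheory.EllipticCurves.Rank1Residual Summit.BirchSwinnertonDyer.Rank1Residual.Additive
open Literature.NumberTheory.GaloisRepresentations.DiscreteGaloisModule (SelmerStructure)
open Summit.BirchSwinnertonDyer.Rank1Residual.X11b

/-! ## §0 Three elementary helpers -/

/-- A finite place `v` of `ℚ` containing the rational prime `p` is the place of `p`: `primesEquiv v = p`. [folklore] -/
private theorem coe_primesEquiv_eq_of_natCast_mem {p : ℕ} [hp : Fact p.Prime] {v : HeightOneSpectrum (𝓞 ℚ)}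
    (hpv : (p : 𝓞 ℚ) ∈ v.asIdeal) : ((Rat.HeightOneSpectrum.primesEquiv v : Nat.Primes) : ℕ) = p := by
  have h : Rat.HeightOneSpectrum.natGenerator v ∣ p := by
    rw [Rat.HeightOneSpectrum.natGenerator_dvd_iff, ← map_natCast (Rat.IsIntegralClosure.intEquiv (𝓞 ℚ)) p]
    exact Ideal.mem_map_of_mem _ hpv
  exact (Nat.prime_dvd_prime_iff_eq (Rat.HeightOneSpectrum.prime_natGenerator v) hp.out).mp h

/-- **`#(𝓞_v / p^J) = p^J`** for the place `v ∋ p` of `ℚ` (`𝓞_v ≅ ℤ_p`, Mathlib's `padicIntEquiv`, and `ℤ_p/p^J ≅ ℤ/p^J`,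
`PadicInt.ker_toZModPow`). [folklore] -/
theorem natCard_adicCompletionIntegers_quotient_span_pow {p : ℕ} [hp : Fact p.Prime] {v : HeightOneSpectrum (𝓞 ℚ)}
    (hpv : (p : 𝓞 ℚ) ∈ v.asIdeal) (J : ℕ) :
    Nat.card (v.adicCompletionIntegers ℚ ⧸ Ideal.span {((p ^ J : ℕ) : v.adicCompletionIntegers ℚ)}) = p ^ J := by
  obtain rfl : ((Rat.HeightOneSpectrum.primesEquiv v : Nat.Primes) : ℕ) = p := coe_primesEquiv_eq_of_natCast_mem hpv
  set q : ℕ := ((Rat.HeightOneSpectrum.primesEquiv v : Nat.Primes) : ℕ) with hq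
  let e : v.adicCompletionIntegers ℚ ≃+* ℤ_[q] :=
    (Rat.HeightOneSpectrum.adicCompletionIntegers.padicIntEquiv v).toRingEquiv
  have hI : Ideal.span {(q : ℤ_[q]) ^ J} =
      Ideal.map (e : v.adicCompletionIntegers ℚ →+* ℤ_[q]) (Ideal.span {((q ^ J : ℕ) : v.adicCompletionIntegers ℚ)}) := by
    rw [Ideal.map_span, Set.image_singleton, RingHom.coe_coe, map_natCast, Nat.cast_pow]
  rw [Nat.card_congr (Ideal.quotientEquiv _ _ e hI).toEquiv, ← PadicInt.ker_toZModPow,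
    Nat.card_congr (RingHom.quotientKerEquivOfSurjective (ZMod.ringHom_surjective (PadicInt.toZModPow J))).toEquiv,
    Nat.card_zmod]

/-- No `2`-torsion ⟹ no `2^k`-torsion. [folklore] -/
private theorem eq_zero_of_two_pow_nsmul_eq_zero {A : Type*} [AddCommGroup A] (h : ∀ a : A, 2 • a = 0 → a = 0) :
    ∀ (k : ℕ) (a : A), 2 ^ k • a = 0 → a = 0 := by
  intro k
  induction k with
  | zero => intro a ha; rwa [pow_zero, one_smul] at ha
  | succ k ih => intro a ha; rw [pow_succ, mul_smul] at ha; exact h a (ih _ ha)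

/-- Two subgroups of a finite abelian group meeting in `0` whose orders multiply to at least the order of the group generate it.
[folklore] -/
private theorem sup_eq_top_of_inf_eq_bot_of_card_le {G : Type*} [AddCommGroup G] [Finite G] (H N : AddSubgroup G)
    (hHN : H ⊓ N = ⊥) (hcard : Nat.card G ≤ Nat.card H * Nat.card N) : H ⊔ N = ⊤ := by
  let f : H × N → ↥(H ⊔ N) := fun x ↦
    ⟨(x.1 : G) + x.2, add_mem (AddSubgroup.mem_sup_left x.1.2) (AddSubgroup.mem_sup_right x.2.2)⟩
  have hinj : Function.Injective f := by
    rintro ⟨h₁, n₁⟩ ⟨h₂, n₂⟩ hx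
    have hx' : (h₁ : G) + n₁ = h₂ + n₂ := congrArg Subtype.val hx
    have hsub : (h₁ : G) - h₂ = n₂ - n₁ := by
      rw [sub_eq_sub_iff_add_eq_add, hx', add_comm]
    have hN : (h₁ : G) - h₂ ∈ N := by rw [hsub]; exact sub_mem n₂.2 n₁.2
    have hmem : (h₁ : G) - h₂ ∈ H ⊓ N := AddSubgroup.mem_inf.mpr ⟨sub_mem h₁.2 h₂.2, hN⟩
    rw [hHN, AddSubgroup.mem_bot, sub_eq_zero] at hmem
    have hn : (n₁ : G) = n₂ := by
      rw [hmem] at hx'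
      exact add_left_cancel hx'
    exact Prod.ext (Subtype.ext hmem) (Subtype.ext hn)
  have hle : Nat.card H * Nat.card N ≤ Nat.card ↥(H ⊔ N) := by
    rw [← Nat.card_prod]
    exact Nat.card_le_card_of_injective f hinj
  exact AddSubgroup.eq_top_of_card_eq _ (le_antisymm (AddSubgroup.card_le_card_addGroup _) (hcard.trans hle))

/-! ## §1 The local line glue -/

/-- **Line complement (B3loc) from the E-side transversality + line bound and the local Euler–Poincaré characteristic**: the
hypothesis `hloc` of `position_of_complement_of_lineCount` (VERBATIM). See the module docstring for the proof.
[cite: MilneADT2006, I Thm. 2.8, Thm. 3.2 and Lemma 3.3] [cite: GreenbergLNM1716, §4 pp. 122–124] -/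
theorem lineComplement_of_transversal_of_lineCard
    (hE : ∀ (W : WeierstrassCurve ℚ) [W.IsElliptic] [W.IsGloballyMinimal], GoodSS W 2 →
      ∀ (κ : ZpExtension ℚ 2), κ.IsCyclotomic →
      ∀ (v : HeightOneSpectrum (𝓞 ℚ)), (2 : 𝓞 ℚ) ∈ v.asIdeal →
      ∀ (g : Field.absoluteGaloisGroup (v.adicCompletion ℚ)) (c : ℕ → localPoints W (v.adicCompletion ℚ)),
        κ.IsTopGenerator (resGalOfEmb (closureEmb (K := ℚ) (v.adicCompletion ℚ)) g) →
        (∀ n, c n ∈ localLayerPointsOfEmb κ (closureEmb (K := ℚ) (v.adicCompletion ℚ)) W n) →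
        (∀ n, 1 ≤ n → localTraceOfEmb κ (closureEmb (K := ℚ) (v.adicCompletion ℚ)) W n (n + 1)
          (c (n + 1)) = W.frobeniusTrace 2 • c n - c (n - 1)) →
        (∀ z₀ : localLayerPointsOfEmb κ (closureEmb (K := ℚ) (v.adicCompletion ℚ)) W 0 →+ ℤ_[2],
          evalOn W (localLayerPointsOfEmb κ (closureEmb (K := ℚ) (v.adicCompletion ℚ)) W 0) z₀ (c 0) = 0 → z₀ = 0) →
        (∀ a : ℤ_[2],
          (∃ z₀ : localLayerPointsOfEmb κ (closureEmb (K := ℚ) (v.adicCompletion ℚ)) W 0 →+ ℤ_[2],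
            evalOn W (localLayerPointsOfEmb κ (closureEmb (K := ℚ) (v.adicCompletion ℚ)) W 0) z₀ (c 0) = 2 * a) →
          ∃ y : localLayerPointsOfEmb κ (closureEmb (K := ℚ) (v.adicCompletion ℚ)) W 0 →+ ℤ_[2],
            evalOn W (localLayerPointsOfEmb κ (closureEmb (K := ℚ) (v.adicCompletion ℚ)) W 0) y (c 0) = a) →
        (∃ cneg : localPoints W (v.adicCompletion ℚ),
          Summit.BirchSwinnertonDyer.Rank1Residual.F1Sign2.IsHondaSystemAtTwo κ (closureEmb (K := ℚ) (v.adicCompletion ℚ)) W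
            (W.frobeniusTrace 2) g cneg c) →
      ∃ J₃ : ℕ, ∀ J : ℕ, J₃ ≤ J →
        W.twistedSharpFlatLocalFamily 2 κ J (-1) OddBlindTwist.two_dvd_neg_one_sub_one v
            (localTowerPointsOfEmb κ (closureEmb (K := ℚ) (v.adicCompletion ℚ)) W)
            (colemanKer κ (closureEmb (K := ℚ) (v.adicCompletion ℚ)) W (W.frobeniusTrace 2) g c .flat) v ⊓
          W.twistedTorsionLocalKummer 2 κ J (-1) OddBlindTwist.two_dvd_neg_one_sub_one (v.adicCompletion ℚ)
            (localLayerPointsOfEmb κ (closureEmb (K := ℚ) (v.adicCompletion ℚ)) W 1 ⊓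
              (DistribSMul.toAddMonoidHom (localPoints W (v.adicCompletion ℚ)) g + AddMonoidHom.id _).ker) = ⊥ ∧
        2 ^ J ≤ Nat.card (W.twistedSharpFlatLocalFamily 2 κ J (-1) OddBlindTwist.two_dvd_neg_one_sub_one v
            (localTowerPointsOfEmb κ (closureEmb (K := ℚ) (v.adicCompletion ℚ)) W)
            (colemanKer κ (closureEmb (K := ℚ) (v.adicCompletion ℚ)) W (W.frobeniusTrace 2) g c .flat) v))
    (hEP : ∀ v : HeightOneSpectrum (𝓞 ℚ), (2 : 𝓞 ℚ) ∈ v.asIdeal →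
      Literature.NumberTheory.GaloisRepresentations.localEulerPoincareCharacteristic (v.adicCompletion ℚ)) :
∀ (W : WeierstrassCurve ℚ) [W.IsElliptic] [W.IsGloballyMinimal], GoodSS W 2 →
  ∀ (κ : ZpExtension ℚ 2), κ.IsCyclotomic →
  ∀ (v : HeightOneSpectrum (𝓞 ℚ)), (2 : 𝓞 ℚ) ∈ v.asIdeal →
  ∀ (g : Field.absoluteGaloisGroup (v.adicCompletion ℚ)) (c : ℕ → localPoints W (v.adicCompletion ℚ)),
    κ.IsTopGenerator (resGalOfEmb (closureEmb (K := ℚ) (v.adicCompletion ℚ)) g) →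
    (∀ n, c n ∈ localLayerPointsOfEmb κ (closureEmb (K := ℚ) (v.adicCompletion ℚ)) W n) →
    (∀ n, 1 ≤ n → localTraceOfEmb κ (closureEmb (K := ℚ) (v.adicCompletion ℚ)) W n (n + 1)
      (c (n + 1)) = W.frobeniusTrace 2 • c n - c (n - 1)) →
    (∀ z₀ : localLayerPointsOfEmb κ (closureEmb (K := ℚ) (v.adicCompletion ℚ)) W 0 →+ ℤ_[2],
      evalOn W (localLayerPointsOfEmb κ (closureEmb (K := ℚ) (v.adicCompletion ℚ)) W 0) z₀ (c 0) = 0 → z₀ = 0) →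
    (∀ a : ℤ_[2],
      (∃ z₀ : localLayerPointsOfEmb κ (closureEmb (K := ℚ) (v.adicCompletion ℚ)) W 0 →+ ℤ_[2],
        evalOn W (localLayerPointsOfEmb κ (closureEmb (K := ℚ) (v.adicCompletion ℚ)) W 0) z₀ (c 0) = 2 * a) →
      ∃ y : localLayerPointsOfEmb κ (closureEmb (K := ℚ) (v.adicCompletion ℚ)) W 0 →+ ℤ_[2],
        evalOn W (localLayerPointsOfEmb κ (closureEmb (K := ℚ) (v.adicCompletion ℚ)) W 0) y (c 0) = a) →
    (∃ cneg : localPoints W (v.adicCompletion ℚ),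
      Summit.BirchSwinnertonDyer.Rank1Residual.F1Sign2.IsHondaSystemAtTwo κ (closureEmb (K := ℚ) (v.adicCompletion ℚ)) W
        (W.frobeniusTrace 2) g cneg c) →
  ∀ (W₂ : WeierstrassCurve ℚ) [W₂.IsElliptic] [W₂.IsGloballyMinimal],
    (∃ C : WeierstrassCurve.VariableChange ℚ, C • W.quadraticTwist 2 = W₂) →
  ∃ J₃ : ℕ, ∀ J : ℕ, J₃ ≤ J →
  ∀ (φ : (W₂.torsionGaloisModule ((2 ^ J : ℕ) : ℤ)).toContRepresentation →ⁱL
      (W.twistedTorsionGaloisModule 2 κ J (-1) OddBlindTwist.two_dvd_neg_one_sub_one).toContRepresentation)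
    (ψ : (W.twistedTorsionGaloisModule 2 κ J (-1) OddBlindTwist.two_dvd_neg_one_sub_one).toContRepresentation →ⁱL
      (W₂.torsionGaloisModule ((2 ^ J : ℕ) : ℤ)).toContRepresentation),
    (∀ a, ψ (φ a) = a) → (∀ b, φ (ψ b) = b) →
    (∀ w : InfinitePlace ℚ, ((W.twistedTorsionToLocalH1 2 κ J (-1) OddBlindTwist.two_dvd_neg_one_sub_one w.Completion).ker).map
        (galoisCohomology.map (ψ.restrictField w.Completion) 1) =
      W₂.kummerLocalConditionAt ((2 ^ J : ℕ) : ℤ) w.Completion) →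
    (∀ v' : HeightOneSpectrum (𝓞 ℚ), v' ≠ v →
      (W.twistedSharpFlatLocalFamily 2 κ J (-1) OddBlindTwist.two_dvd_neg_one_sub_one v
          (localTowerPointsOfEmb κ (closureEmb (K := ℚ) (v.adicCompletion ℚ)) W)
          (colemanKer κ (closureEmb (K := ℚ) (v.adicCompletion ℚ)) W (W.frobeniusTrace 2) g c .flat) v').map
        (galoisCohomology.map (ψ.restrictField (v'.adicCompletion ℚ)) 1) =
      ((resH1Hom (Literature.NumberTheory.EllipticCurves.subgroupIncl (localSubgroup κ.kerSubgroup (v'.adicCompletion ℚ)))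
          (AddMonoidHom.id (localPoints W₂ (v'.adicCompletion ℚ))) (fun _ _ ↦ rfl)).ker).comap
        (galoisCohomology.map (W₂.torsionPointsMapIntertwining ((2 ^ J : ℕ) : ℤ) (v'.adicCompletion ℚ)) 1)) →
    (W₂.kummerLocalConditionAt ((2 ^ J : ℕ) : ℤ) (v.adicCompletion ℚ)).map
        (galoisCohomology.map (φ.restrictField (v.adicCompletion ℚ)) 1) ≤
      W.twistedTorsionLocalKummer 2 κ J (-1) OddBlindTwist.two_dvd_neg_one_sub_one (v.adicCompletion ℚ)
        (localLayerPointsOfEmb κ (closureEmb (K := ℚ) (v.adicCompletion ℚ)) W 1 ⊓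
          (DistribSMul.toAddMonoidHom (localPoints W (v.adicCompletion ℚ)) g + AddMonoidHom.id _).ker) →
    (W.twistedSharpFlatLocalFamily 2 κ J (-1) OddBlindTwist.two_dvd_neg_one_sub_one v
        (localTowerPointsOfEmb κ (closureEmb (K := ℚ) (v.adicCompletion ℚ)) W)
        (colemanKer κ (closureEmb (K := ℚ) (v.adicCompletion ℚ)) W (W.frobeniusTrace 2) g c .flat) v).map
      (galoisCohomology.map (ψ.restrictField (v.adicCompletion ℚ)) 1) ⊓
      W₂.kummerLocalConditionAt ((2 ^ J : ℕ) : ℤ) (v.adicCompletion ℚ) = ⊥ ∧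
    (W.twistedSharpFlatLocalFamily 2 κ J (-1) OddBlindTwist.two_dvd_neg_one_sub_one v
        (localTowerPointsOfEmb κ (closureEmb (K := ℚ) (v.adicCompletion ℚ)) W)
        (colemanKer κ (closureEmb (K := ℚ) (v.adicCompletion ℚ)) W (W.frobeniusTrace 2) g c .flat) v).map
      (galoisCohomology.map (ψ.restrictField (v.adicCompletion ℚ)) 1) ⊔
      W₂.kummerLocalConditionAt ((2 ^ J : ℕ) : ℤ) (v.adicCompletion ℚ) = ⊤ := by
  intro W _ _ hss κ hκ v hv g c hg hc htr hz hsat hH W₂ _ _ htw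
  haveI : Fact (Nat.Prime 2) := ⟨Nat.prime_two⟩
  obtain ⟨J₃, hJ₃⟩ := hE W hss κ hκ v hv g c hg hc htr hz hsat hH
  refine ⟨max J₃ 1, fun J hJ φ ψ h₁ h₂ hinf hne hiv ↦ ?_⟩
  have hJ1 : 1 ≤ J := le_of_max_le_right hJ
  obtain ⟨hbotE, hcardE⟩ := hJ₃ J (le_of_max_le_left hJ)
  set LE := W.twistedSharpFlatLocalFamily 2 κ J (-1) OddBlindTwist.two_dvd_neg_one_sub_one v
      (localTowerPointsOfEmb κ (closureEmb (K := ℚ) (v.adicCompletion ℚ)) W)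
      (colemanKer κ (closureEmb (K := ℚ) (v.adicCompletion ℚ)) W (W.frobeniusTrace 2) g c .flat) v with hLE
  set T₁ := W.twistedTorsionLocalKummer 2 κ J (-1) OddBlindTwist.two_dvd_neg_one_sub_one (v.adicCompletion ℚ)
      (localLayerPointsOfEmb κ (closureEmb (K := ℚ) (v.adicCompletion ℚ)) W 1 ⊓
        (DistribSMul.toAddMonoidHom (localPoints W (v.adicCompletion ℚ)) g + AddMonoidHom.id _).ker) with hT₁
  set KJ := W₂.kummerLocalConditionAt ((2 ^ J : ℕ) : ℤ) (v.adicCompletion ℚ) with hKJ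
  set Ψ := galoisCohomology.map (ψ.restrictField (v.adicCompletion ℚ)) 1 with hΨ
  set Φ := galoisCohomology.map (φ.restrictField (v.adicCompletion ℚ)) 1 with hΦ
  have hΦΨ : ∀ l, Φ (Ψ l) = l := fun l ↦
    CongruentTransfer.map_restrictField_map_restrictField_of_comp_eq ψ φ h₂ (Sum.inr v) l
  have hΨinj : Function.Injective Ψ :=
    CongruentTransfer.map_restrictField_injective_of_comp_eq ψ φ h₂ (Sum.inr v)
  -- (⊥)
  have hbot : LE.map Ψ ⊓ KJ = ⊥ := by
    rw [eq_bot_iff]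
    rintro y ⟨⟨l, hl, rfl⟩, hyK⟩
    have h3 : Φ (Ψ l) ∈ T₁ := hiv ⟨Ψ l, hyK, rfl⟩
    rw [hΦΨ] at h3
    have h4 : l ∈ LE ⊓ T₁ := ⟨hl, h3⟩
    rw [hbotE, AddSubgroup.mem_bot] at h4
    rw [AddSubgroup.mem_bot, h4, map_zero]
  refine ⟨hbot, ?_⟩
  -- (⊤) counting
  have hv' : ((2 : ℕ) : 𝓞 ℚ) ∈ v.asIdeal := by exact_mod_cast hv
  have h0v := forall_two_nsmul_eq_zero_adicCompletion_twist_of_goodSS W hss W₂ htw v hv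
  have hker : Nat.card (nsmulAddMonoidHom (2 ^ J) :
      (W₂.baseChange (v.adicCompletion ℚ)).toAffine.Point →+ _).ker = 1 := by
    have hk : (nsmulAddMonoidHom (2 ^ J) : (W₂.baseChange (v.adicCompletion ℚ)).toAffine.Point →+ _).ker = ⊥ := by
      rw [eq_bot_iff]
      intro P hP
      rw [AddMonoidHom.mem_ker, nsmulAddMonoidHom_apply] at hP
      exact (AddSubgroup.mem_bot).mpr (eq_zero_of_two_pow_nsmul_eq_zero h0v J P hP)
    rw [hk, AddSubgroup.card_bot]
  have hq : Nat.card (v.adicCompletionIntegers ℚ ⧸ Ideal.span {((2 ^ J : ℕ) : v.adicCompletionIntegers ℚ)}) = 2 ^ J :=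
    natCard_adicCompletionIntegers_quotient_span_pow (p := 2) hv' J
  have hKcard : Nat.card KJ = 2 ^ J := by
    have h := W₂.natCard_kummerLocalConditionAt_adicCompletion v (n := 2 ^ J) (pow_ne_zero _ two_ne_zero)
    rw [hker, hq, one_mul] at h
    exact h
  haveI : NeZero (2 ^ J) := ⟨pow_ne_zero _ two_ne_zero⟩
  have hpp : IsPrimePow (2 ^ J) := Nat.prime_two.isPrimePow.pow (by omega)
  have hH1 := natCard_torsionBy_galoisCohomology_localGaloisModule_eq_of_localEuler W₂ v (2 ^ J) hpp (hEP v hv)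
  rw [hker, hq, one_mul] at hH1
  have hA := natCard_torsionBy_galoisCohomology_localGaloisModule_mul W₂ v (n := 2 ^ J) (pow_ne_zero _ two_ne_zero)
  rw [hH1, hker, hq, one_mul] at hA
  -- `hA : 2 ^ J * 2 ^ J = #A_J`
  have hLcard : Nat.card (LE.map Ψ) = Nat.card LE :=
    (Nat.card_congr (AddSubgroup.equivMapOfInjective LE Ψ hΨinj).toEquiv).symm
  haveI : Finite (galoisCohomology ((W₂.torsionGaloisModule ((2 ^ J : ℕ) : ℤ)).restrictField (v.adicCompletion ℚ)) 1) :=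
    Nat.finite_of_card_ne_zero (by rw [← hA]; positivity)
  refine sup_eq_top_of_inf_eq_bot_of_card_le _ _ hbot ?_
  rw [← hA, hLcard, hKcard]
  exact Nat.mul_le_mul_right _ hcardE

end OddBlindLocal

end Summit.BirchSwinnertonDyer.BirchSwinnertonDyer.Theorems
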